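import Summits.AtomisticToContinuum.BoseEinsteinCondensation.Theorems.BECPhaseQuadratureSumRuleSumRuleChainGlueDichotomy
import Summits.AtomisticToContinuum.BoseEinsteinCondensation.Theorems.BECInsertionCorrectorCorrectorClosureVolumeHomotopyReductionBEC
import Literature.MathematicalPhysics.QuantumManyBody.PeriodicClusteringFromKyFanGap
import Literature.MathematicalPhysics.QuantumManyBody.WeightedCorrector
import HarnessLib

/-!
# Crux `CorrectorClosure` (stmt-AtomisticToContinuum-12058), line `volume-homotopy-sum-rule-domination` —
# registered stub `stub_concentrationOfMoments`, auxiliary file 2/2: the zero-mode dictionary and the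
# Kipnis–Varadhan sandwich at the positive minimiser

Supports (does not close) stmt-AtomisticToContinuum-12058, route `BECInsertionCorrector`.

For a REAL periodic trial state `Φ` of `N = n + 2` bosons on the torus of side `L` (`Φ = F`,
`F : Config (n+2) → ℝ`), the zero-mode counting operator `N̂₀ = Σⱼ Pⱼ = a_0†a_0` acts as
`(N̂₀F)(X) = G(X) := Σⱼ L⁻³ ∫_cell F(X with xⱼ ↦ y) dy` (`cm_numOp_apply`, PQSR's `modeCr_condAn_apply`).
The two identities of the dictionary are then read off the tree's Fock-layer toolkit:

* `cm_integral_mul_numOp` — `⟨F, N̂₀F⟩ = ∫ F G = n₀(Φ)` (`WF.integral_conj_numOp_mul`: `⟨Φ, a†aΦ⟩ = ‖aΦ‖²`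
  and `‖a_0Φ‖² = condensateOccupation`);
* `cm_ofReal_integral_numOp_sq` — `‖N̂₀F‖² = ∫ G² = N(N−1)L⁻⁶∫_{cell^n}|∫∫Φ|² + n₀(Φ)`, i.e. EXACTLY the
  left-hand side of 12616′ (`WF.normSq_modeCr`: `‖a_0†Θ‖² = ‖Θ‖² + ‖a_0Θ‖²` with `Θ = a_0Φ`, PQSR's
  `normSq_condAn` and `pairOcc_zero`).

With the ratio `g = G/F` (for `F > 0`) and its `F²`-mean `m = ∫ gF² = n₀`, the removal Pythagoras
identity `vhr_integral_centredRatio_sq` gives `Var := ∫(g − m)²F² = ∫G² − n₀²`, and Kipnis–Varadhan's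
criterion `sq_integral_sq_le_of_hMinusOneSqW_le` with an `H₋₁` bound `B` on `g − m` and a Dirichlet
bound `𝓔_F(g,g) ≤ D`, `D·B ≤ (ζN²)²`, yields `Var ≤ ζN²`: this is `cm_concentration_at`, the inequality
12616′ AT `Φ`, from the bodies of stubs S3a (f-sum) and S3b (susceptibility) at `Φ`.

## References

* [LSSY2005] E. H. Lieb, R. Seiringer, J. P. Solovej, J. Yngvason, *The Mathematics of the Bose Gas and
  its Condensation*, App. A (A.7), (A.11), (A.13)–(A.14) (`a`, `a†`, CCR).
* [KipnisLandim1999] C. Kipnis, C. Landim, *Scaling Limits of Interacting Particle Systems*, App. 1 §6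
  (6.1) (the `H₋₁` variational formula).
* [PitaevskiiStringari1991] L. Pitaevskii, S. Stringari, *Uncertainty principle, quantum fluctuations,
  and broken symmetries*, (9) (the moment sandwich).
-/

noncomputable section

open MeasureTheory Filter Matrix
open scoped ENNReal NNReal BigOperators ComplexConjugate

namespace Summit.AtomisticToContinuum.BoseEinsteinCondensation.Theorems.CorrectorClosure.VolumeHomotopySumRuleDomination

open Literature.MathematicalPhysics.QuantumManyBody.BoseGas
open Summit.AtomisticToContinuum.BoseEinsteinCondensation.Theorems.SumRuleChainGlue
open Summit.AtomisticToContinuum.BoseEinsteinCondensation.Cruxes.PeriodicIRBound.LinearPhFloorWagner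
open Summit.AtomisticToContinuum.BoseEinsteinCondensation.Theorems.CorrectorClosure.Negative
  (sq_integral_sq_le_of_hMinusOneSqW_le)

variable {n : ℕ} {L : ℝ}

/-! ### The zero-mode counting operator on a real state -/

/-- A slot integral of a real-valued state is real:
`∫_cell Φ(X with xⱼ ↦ y) dy = ∫_cell F(X with xⱼ ↦ y) dy` for `Φ = F`. [folklore] -/
theorem cm_setIntegral_update_ofReal {Φ : Config (n + 2) → ℂ} {F : Config (n + 2) → ℝ}
    (hF : ∀ X, Φ X = (F X : ℂ)) (X : Config (n + 2)) (j : Fin (n + 2)) :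
    ∫ y in cell L, Φ (Function.update X j y) =
      ((∫ y in cell L, F (Function.update X j y) : ℝ) : ℂ) := by
  have h : (fun y => Φ (Function.update X j y)) = fun y => ((F (Function.update X j y) : ℝ) : ℂ) :=
    funext fun y => hF _
  rw [h, integral_complex_ofReal]

/-- **`N̂₀ = a_0†a_0` on a real state**: `(a_0†a_0Φ)(X) = G(X) = Σⱼ L⁻³∫_cell F(X with xⱼ ↦ y) dy`.
[cite: LSSY2005, App. A (A.13)–(A.14)] -/
theorem cm_numOp_apply (hL : 0 < L) (Φ : PeriodicTrialState (n + 2) L) {F G : Config (n + 2) → ℝ}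
    (hF : ∀ X, Φ.ψ X = (F X : ℂ))
    (hG : ∀ X, G X = ∑ j, (L ^ 3)⁻¹ * ∫ y in cell L, F (Function.update X j y)) (X : Config (n + 2)) :
    modeCr (planeWaveMode L 0) (condAn L Φ.ψ) X = ((G X : ℝ) : ℂ) := by
  rw [modeCr_condAn_apply (WF.isCore_trialState Φ).symm hL 0 X, hG X, Complex.ofReal_sum]
  refine Finset.sum_congr rfl fun j _ => ?_
  rw [cellWave_zero, one_mul, cm_setIntegral_update_ofReal hF X j, Complex.ofReal_mul]

/-- `N̂₀Φ` is continuous (a finite sum of cell averages of a continuous function). [folklore] -/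
theorem cm_continuous_numOp (hL : 0 < L) (Φ : PeriodicTrialState (n + 2) L)
    {F G : Config (n + 2) → ℝ} (hF : ∀ X, Φ.ψ X = (F X : ℂ))
    (hG : ∀ X, G X = ∑ j, (L ^ 3)⁻¹ * ∫ y in cell L, F (Function.update X j y)) : Continuous G := by
  have h : Continuous fun X => (modeCr (planeWaveMode L 0) (condAn L Φ.ψ) X).re :=
    Complex.continuous_re.comp
      (WF.continuous_modeCr (continuous_planeWaveMode L 0) (continuous_condAn hL Φ))
  have heq : (fun X => (modeCr (planeWaveMode L 0) (condAn L Φ.ψ) X).re) = G :=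
    funext fun X => by rw [cm_numOp_apply hL Φ hF hG X, Complex.ofReal_re]
  rwa [heq] at h

/-- A real-valued periodic trial state has a continuous real part `F`. [folklore] -/
theorem cm_continuous_real (Φ : PeriodicTrialState (n + 2) L) {F : Config (n + 2) → ℝ}
    (hF : ∀ X, Φ.ψ X = (F X : ℂ)) : Continuous F := by
  have h : Continuous fun X => (Φ.ψ X).re := Complex.continuous_re.comp Φ.contDiff.continuous
  have heq : (fun X => (Φ.ψ X).re) = F := funext fun X => by rw [hF X, Complex.ofReal_re]
  rwa [heq] at h

/-- A real-valued periodic trial state is `F²dX`-normalised on the cell: `∫ F² = 1`. [folklore] -/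
theorem cm_integral_real_sq_eq_one (Φ : PeriodicTrialState (n + 2) L) {F : Config (n + 2) → ℝ}
    (hF : ∀ X, Φ.ψ X = (F X : ℂ)) : ∫ X in cellN (n + 2) L, F X ^ 2 = 1 := by
  have h := integral_cellN_norm_sq_eq_toReal L Φ.contDiff.continuous
  rw [Φ.norm_eq, ENNReal.toReal_one] at h
  rw [← h]
  refine integral_congr_ae (ae_of_all _ fun X => ?_)
  show F X ^ 2 = ‖Φ.ψ X‖ ^ 2
  rw [hF X, Complex.norm_real, Real.norm_eq_abs, sq_abs]

/-! ### The two identities of the zero-mode dictionary -/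

/-- **`⟨Φ, N̂₀Φ⟩ = ∫ F G = n₀(Φ)`** for a real periodic trial state `Φ = F` (`⟨Φ, a_0†a_0Φ⟩ = ‖a_0Φ‖²`,
and `‖a_0Φ‖²` is the condensate occupation). [cite: LSSY2005, App. A (A.11), (A.13)–(A.14)] -/
theorem cm_integral_mul_numOp (hL : 0 < L) (Φ : PeriodicTrialState (n + 2) L)
    {F G : Config (n + 2) → ℝ} (hF : ∀ X, Φ.ψ X = (F X : ℂ))
    (hG : ∀ X, G X = ∑ j, (L ^ 3)⁻¹ * ∫ y in cell L, F (Function.update X j y)) :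
    ∫ X in cellN (n + 2) L, F X * G X = (condensateOccupation (n + 2) L Φ.ψ).toReal := by
  have h := WF.integral_conj_numOp_mul hL 0 (WF.isCore_trialState Φ)
  rw [cellOccupation_planeWaveMode, momentumOccupation_zero] at h
  have hpt : (fun X => conj (modeCr (planeWaveMode L 0) (modeAn L (planeWaveMode L 0) Φ.ψ) X) * Φ.ψ X) =
      fun X => ((F X * G X : ℝ) : ℂ) := by
    funext X
    rw [show modeAn L (planeWaveMode L 0) Φ.ψ = condAn L Φ.ψ from rfl, cm_numOp_apply hL Φ hF hG X,
      Complex.conj_ofReal, hF X, ← Complex.ofReal_mul, mul_comm]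
  rw [hpt, integral_complex_ofReal] at h
  exact_mod_cast h

/-- **`‖N̂₀Φ‖² = N(N−1)L⁻⁶∫_{cell^n}|∫∫Φ|² + n₀(Φ)`** for EVERY periodic trial state of `n + 2` bosons
(`‖a_0†Θ‖² = ‖Θ‖² + ‖a_0Θ‖²` by the CCR with `Θ = a_0Φ`, `‖a_0Φ‖² = n₀(Φ)`, and `‖a_0a_0Φ‖²` is the pair
term of 12616′). [cite: LSSY2005, App. A (A.7), (A.13)–(A.14)] -/
theorem cm_normSq_numOp (hL : 0 < L) (Φ : PeriodicTrialState (n + 2) L) :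
    WF.normSq L (modeCr (planeWaveMode L 0) (condAn L Φ.ψ)) =
      ((n + 2 : ℕ) : ℝ≥0∞) * ((n + 1 : ℕ) : ℝ≥0∞) *
      (∫⁻ Y in cellN n L,
      (‖∫ x in cell L, ∫ y in cell L, Φ.ψ (vecCons x (vecCons y Y))‖₊ : ℝ≥0∞) ^ 2) /
      ENNReal.ofReal (L ^ 6) +
      condensateOccupation (n + 2) L Φ.ψ := by
  rw [WF.normSq_modeCr hL 0 (isCore_condAn hL Φ), normSq_condAn hL Φ, ← pairOcc_eq_cellOccupation hL Φ 0,
    pairOcc_zero hL Φ, add_comm]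

/-- **`∫ G² = ‖N̂₀Φ‖² =` the left-hand side of 12616′** for a real periodic trial state `Φ = F`.
[cite: LSSY2005, App. A (A.7), (A.13)–(A.14)] -/
theorem cm_ofReal_integral_numOp_sq (hL : 0 < L) (Φ : PeriodicTrialState (n + 2) L)
    {F G : Config (n + 2) → ℝ} (hF : ∀ X, Φ.ψ X = (F X : ℂ))
    (hG : ∀ X, G X = ∑ j, (L ^ 3)⁻¹ * ∫ y in cell L, F (Function.update X j y)) :
    ENNReal.ofReal (∫ X in cellN (n + 2) L, G X ^ 2) =
      ((n + 2 : ℕ) : ℝ≥0∞) * ((n + 1 : ℕ) : ℝ≥0∞) *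
      (∫⁻ Y in cellN n L,
      (‖∫ x in cell L, ∫ y in cell L, Φ.ψ (vecCons x (vecCons y Y))‖₊ : ℝ≥0∞) ^ 2) /
      ENNReal.ofReal (L ^ 6) +
      condensateOccupation (n + 2) L Φ.ψ := by
  have hGc : Continuous G := cm_continuous_numOp hL Φ hF hG
  rw [← cm_normSq_numOp hL Φ, WF.normSq,
    ofReal_integral_eq_lintegral_ofReal (integrableOn_cellN (f := fun X => G X ^ 2) (hGc.pow 2) L)
      (ae_of_all _ fun X => sq_nonneg (G X))]
  refine lintegral_congr fun X => ?_
  rw [cm_numOp_apply hL Φ hF hG X, coe_nnnorm_sq_eq_ofReal, Complex.norm_real, Real.norm_eq_abs,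
    sq_abs]

/-! ### The Kipnis–Varadhan sandwich at the positive minimiser -/

/-- **12616′ at a real positive state from its two zero-mode moments.** Let `Φ = F > 0` be a real,
nowhere-vanishing periodic trial state of `n + 2` bosons, `G = N̂₀F`, `g = G/F` the zero-mode counting
ratio and `m = ∫ g F²` its mean. If `g` is a periodic test function with `𝓔_F(g,g) ≤ D` (the f-sum
bound, stub S3a), `‖g − m‖²₋₁ ≤ B` (the susceptibility bound, stub S3b) and `D·B ≤ (ζN²)²`, then
`N(N−1)L⁻⁶∫|∫∫Φ|² + n₀(Φ) ≤ n₀(Φ)² + ζN²`: Kipnis–Varadhan's criterion gives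
`(∫(g−m)²F²)² ≤ B·𝓔_F(g−m,g−m) = B·𝓔_F(g,g) ≤ (ζN²)²`, the Pythagoras identity `∫(g−m)²F² = ∫G² − m²`
and the dictionary `m = n₀`, `∫G² = LHS` conclude. [cite: PitaevskiiStringari1991, (9)] -/
theorem cm_concentration_at (hL : 0 < L) (Φ : PeriodicTrialState (n + 2) L)
    {F G : Config (n + 2) → ℝ} (hF : ∀ X, Φ.ψ X = (F X : ℂ)) (hFpos : ∀ X, 0 < F X)
    (hG : ∀ X, G X = ∑ j, (L ^ 3)⁻¹ * ∫ y in cell L, F (Function.update X j y))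
    {D B ζ : ℝ} (hB : 0 ≤ B) (hζ : 0 ≤ ζ)
    (hg : IsPeriodicTest L fun X => G X / F X)
    (hE : dirichletFormW L F (fun X => G X / F X) (fun X => G X / F X) ≤ D)
    (hH : hMinusOneSqW L F
        (fun X => G X / F X - ∫ Y in cellN (n + 2) L, G Y / F Y * F Y ^ 2) ≤ ENNReal.ofReal B)
    (hDB : D * B ≤ (ζ * ((n : ℝ) + 2) ^ 2) ^ 2) :
    ((n + 2 : ℕ) : ℝ≥0∞) * ((n + 1 : ℕ) : ℝ≥0∞) *
      (∫⁻ Y in cellN n L,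
      (‖∫ x in cell L, ∫ y in cell L, Φ.ψ (vecCons x (vecCons y Y))‖₊ : ℝ≥0∞) ^ 2) /
      ENNReal.ofReal (L ^ 6) +
      condensateOccupation (n + 2) L Φ.ψ ≤
      condensateOccupation (n + 2) L Φ.ψ ^ 2 + ENNReal.ofReal (ζ * ((n : ℝ) + 2) ^ 2) := by
  have hFc : Continuous F := cm_continuous_real Φ hF
  have hGc : Continuous G := cm_continuous_numOp hL Φ hF hG
  have hFne : ∀ X, F X ≠ 0 := fun X => (hFpos X).ne'
  -- notation: the ratio, its mean, its centring
  set g : Config (n + 2) → ℝ := fun X => G X / F X with hg_def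
  set m : ℝ := ∫ Y in cellN (n + 2) L, g Y * F Y ^ 2 with hm_def
  set gc : Config (n + 2) → ℝ := fun X => g X - m with hgc_def
  -- the mean is `⟨F, G⟩ = n₀`
  have hm' : ∫ Y in cellN (n + 2) L, F Y * G Y = m := by
    rw [hm_def]
    refine integral_congr_ae (ae_of_all _ fun Y => ?_)
    show F Y * G Y = g Y * F Y ^ 2
    rw [hg_def]
    field_simp
  have hm_n0 : m = (condensateOccupation (n + 2) L Φ.ψ).toReal := by
    rw [← hm', cm_integral_mul_numOp hL Φ hF hG]
  -- Pythagoras: `∫ (g - m)² F² = ∫ G² - m²`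
  set S : ℝ := ∫ X in cellN (n + 2) L, G X ^ 2 with hS_def
  set P : ℝ := ∫ X in cellN (n + 2) L, gc X * gc X * F X ^ 2 with hP_def
  have hPyth : P = S - m ^ 2 :=
    vhr_integral_centredRatio_sq L hFc hFpos hGc m hm' (cm_integral_real_sq_eq_one Φ hF)
  -- the centred ratio is a periodic test function with the same Dirichlet energy
  have hgc_eq : gc = g - fun _ => m := rfl
  have hgc : IsPeriodicTest L gc := by
    rw [hgc_eq]
    exact hg.sub (IsPeriodicTest.const L m)
  have hDir : dirichletFormW L F gc gc = dirichletFormW L F g g := by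
    rw [hgc_eq, dirichletFormW_sub_sub hFc hg (IsPeriodicTest.const L m), dirichletFormW_const_right,
      dirichletFormW_const_left]
    ring
  -- Kipnis–Varadhan's criterion: `P² ≤ B 𝓔(gc,gc) = B 𝓔(g,g) ≤ B D ≤ (ζN²)²`
  have hKV : P ^ 2 ≤ B * dirichletFormW L F gc gc := sq_integral_sq_le_of_hMinusOneSqW_le hgc hB hH
  have hP2 : P ^ 2 ≤ (ζ * ((n : ℝ) + 2) ^ 2) ^ 2 :=
    calc P ^ 2 ≤ B * dirichletFormW L F gc gc := hKV
      _ = B * dirichletFormW L F g g := by rw [hDir]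
      _ ≤ B * D := mul_le_mul_of_nonneg_left hE hB
      _ = D * B := mul_comm _ _
      _ ≤ (ζ * ((n : ℝ) + 2) ^ 2) ^ 2 := hDB
  have hP0 : 0 ≤ P := integral_nonneg fun X => mul_nonneg (mul_self_nonneg _) (sq_nonneg _)
  have hPle : P ≤ ζ * ((n : ℝ) + 2) ^ 2 :=
    (pow_le_pow_iff_left₀ hP0 (by positivity) two_ne_zero).1 hP2
  have hSle : S ≤ m ^ 2 + ζ * ((n : ℝ) + 2) ^ 2 := by
    rw [hPyth] at hPle
    linarith
  -- back to `ℝ≥0∞`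
  have hn0top : condensateOccupation (n + 2) L Φ.ψ ≠ ⊤ :=
    ne_top_of_le_ne_top (ENNReal.natCast_ne_top _) (condensateOccupation_le_card hL Φ)
  have hn0 : condensateOccupation (n + 2) L Φ.ψ = ENNReal.ofReal m := by
    rw [hm_n0, ENNReal.ofReal_toReal hn0top]
  have hm0 : 0 ≤ m := by
    rw [hm_n0]
    exact ENNReal.toReal_nonneg
  rw [← cm_ofReal_integral_numOp_sq hL Φ hF hG, hn0, ← ENNReal.ofReal_pow hm0,
    ← ENNReal.ofReal_add (by positivity) (by positivity)]
  exact ENNReal.ofReal_le_ofReal hSle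

end Summit.AtomisticToContinuum.BoseEinsteinCondensation.Theorems.CorrectorClosure.VolumeHomotopySumRuleDomination

end
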